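import Summits.MatrixMultiplication.MatrixMultiplication.Theorems.SesquiTensorCore
import Summits.MatrixMultiplication.MatrixMultiplication.Theorems.ConeTensorResidual
import Summits.MatrixMultiplication.MatrixMultiplication.Theorems.ConeTensorApexExponent
import HarnessLib

/-!
# SesquiTensor — the exponent `Ω = ω(S)` of the sesqui-weighted tetrahedron `S_n = T(K₄)_n ⊠ W_n`,
the bracket `10 ≤ Ω ≤ min(5ω, ω(K₄) + ω(W))`, the rim cover `3·ω(K₄) ≤ ω + Ω`, and the comparison
maps inside the spoke/rim family `TetraNoSaving ⟹ SesquiNoSaving ⟹ ConeNoSaving`,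
`ConeFlat ⟹ SesquiFlat`

(decomp-mm lens 6 «barrier-complement carving», gen 15; exponent layer of the node `SesquiCarving`,
the `u = 3/2` member of the spoke/rim family: `u = 1` tetrahedron carving `TetrahedronCarving`
(gen 13), `u = 2` cone carving (gen 14, banked). Companion of `SesquiTensorCore` (the tensor `S_n`,
its covers, grouping and flattening); the cut against the summit and the grouping-class certificate
are in `SesquiTensorCut`.)

THE CUT. `Ω := inf {β | R₄(S_n) = O(n^β)}` (`omegaSesqui`; CVZ19 Def. 1.1.13/1.1.25 for the
weighted graph `K₄` with spokes `n³`, rim `n²`). KERNEL BRACKET: `10 ≤ Ω` (flattening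
`n¹⁰ ≤ R₄(S_n)`), `Ω ≤ ω(K₄) + ω(W) ≤ 2ω + 3ω = 5ω` (Kronecker cover `R₄(S_n) ≤ R₄(T(K₄)_n)·R₄(W_n)`
and the two triangle covers of gen 13/14), `3·ω(K₄) ≤ ω + Ω` (rim cover `R₄(T(K₄)_{n·n²}) ≤
R(⟨n,n,n⟩)·R₄(S_n)` at one large level + `omegaTetra_le_of_level`). Hence over `ℂ`:
**`ω = 2 ⟺ SesquiFlat [Ω ≤ 10] ∧ SesquiNoSaving [5ω ≤ Ω]`** (`SesquiTensorCut.matrixMultiplication_iff_sesqui`),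
both halves NECESSARY, and the family is MONOTONE IN THE SPOKE/RIM RATIO: the residual weakens,
`TetraNoSaving [2ω ≤ ω(K₄)] ⟹ SesquiNoSaving [5ω ≤ Ω] ⟹ ConeNoSaving [3ω ≤ ω(W)]`
(`sesquiNoSaving_of_tetraNoSaving`, `coneNoSaving_of_sesquiNoSaving`), while the attacked piece
strengthens, `ConeFlat [ω(W) ≤ 6] ⟹ SesquiFlat [Ω ≤ 10]` (`omegaSesqui_le_ten_of_omegaCone_le_six`;
`SesquiFlat ⟹ TetraFlat` is CVZ19 Prop. 2.1.7 with `f = (n³,n³,n³,n²,n²,n²)`, not re-proved here —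
in kernel `SesquiFlat ⟹ ω(K₄) ≤ (ω + 10)/3 < 4.13`, `omegaTetra_le_of_omegaSesqui_le_ten`).
INSTRUMENT: one finite certificate `R₄(S_N) ≤ N^θ` (`N ≥ 2`) gives `ω(K₄) ≤ 1 + θ/3`
(`omegaTetra_le_of_sesqui_level`). No `sorry`, no new axiom, no instance, no notation, no
`Prop`-valued definition.
-/

noncomputable section

set_option linter.dupNamespace false

open scoped BigOperators
open Filter Asymptotics Module
open Literature.Computability.AlgebraicComplexity
open Summit.MatrixMultiplication.MatrixMultiplication.Theorems.TetrahedronTensor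
open Summit.MatrixMultiplication.MatrixMultiplication.Theorems.ConeTensor

namespace Summit.MatrixMultiplication.MatrixMultiplication.Theorems.SesquiTensor

/-! ## The exponent `Ω = ω(S)` and the bracket `10 ≤ Ω ≤ 15` -/

section Exponent

variable (F : Type*) [Field F]

/-- Admissible exponents of the sesqui-weighted tetrahedron: `{β | R₄(S_n) = O(n^β)}`.
(CVZ19, Def. 1.1.13). -/
def sesquiAdmissibleExponents : Set ℝ :=
  {β : ℝ | (fun n : ℕ => (tensorRankD (sesqui F n) : ℝ)) =O[atTop] fun n : ℕ => (n : ℝ) ^ β}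

/-- **The exponent of the sesqui-weighted tetrahedron** `Ω = ω(S) = inf {β | R₄(S_n) = O(n^β)}`
(the exponent of the weighted graph `K₄` with spokes `n³` and rim `n²`). Known (below):
`10 ≤ Ω ≤ min(5ω, ω(K₄) + ω(W))`, `3ω(K₄) - ω ≤ Ω`, `ω(6,4,3) ≤ Ω`. (CVZ19, Def. 1.1.25). -/
def omegaSesqui : ℝ :=
  sInf (sesquiAdmissibleExponents F)

/-- `15` is admissible (`R₄(S_n) ≤ n¹⁵`). [cite: ChristandlVranaZuiddam2016, §1.2 (table)] -/
theorem fifteen_mem_sesquiAdmissibleExponents : (15 : ℝ) ∈ sesquiAdmissibleExponents F := by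
  refine IsBigO.of_bound 1 (Eventually.of_forall fun n => ?_)
  rw [one_mul, Real.norm_of_nonneg (Nat.cast_nonneg _),
    Real.norm_of_nonneg (Real.rpow_nonneg (Nat.cast_nonneg _) _)]
  have h := tensorRankD_sesqui_le_pow_fifteen (F := F) n
  calc (tensorRankD (sesqui F n) : ℝ) ≤ (n ^ 15 : ℕ) := by exact_mod_cast h
    _ = (n : ℝ) ^ (15 : ℝ) := by
      rw [show (15 : ℝ) = (15 : ℕ) by norm_num, Real.rpow_natCast]
      push_cast
      ring

/-- Every admissible exponent of `S` is `≥ 10` (flattening `n¹⁰ ≤ R₄(S_n)`).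
[cite: ChristandlVranaZuiddam2016, §1.2 (eq. (flat))] -/
theorem ten_le_of_mem_sesquiAdmissibleExponents {β : ℝ} (hβ : β ∈ sesquiAdmissibleExponents F) :
    10 ≤ β := by
  by_contra hlt
  rw [not_le] at hlt
  obtain ⟨C, hC⟩ := isBigO_iff.1 hβ
  have hev : ∀ᶠ n : ℕ in atTop, (n : ℝ) ^ (10 - β) ≤ C := by
    filter_upwards [hC, eventually_gt_atTop 0] with n hn hn0
    have hn0' : (0 : ℝ) < n := Nat.cast_pos.2 hn0
    rw [Real.norm_of_nonneg (Nat.cast_nonneg _),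
      Real.norm_of_nonneg (Real.rpow_nonneg (Nat.cast_nonneg _) _)] at hn
    have h10 : (n : ℝ) ^ (10 : ℝ) ≤ C * (n : ℝ) ^ β := by
      refine le_trans ?_ hn
      rw [show (10 : ℝ) = (10 : ℕ) by norm_num, Real.rpow_natCast]
      exact_mod_cast pow_ten_le_tensorRankD_sesqui' (F := F) n
    rw [Real.rpow_sub hn0', div_le_iff₀ (Real.rpow_pos_of_pos hn0' _)]
    exact h10
  have hlim : Tendsto (fun n : ℕ => (n : ℝ) ^ (10 - β)) atTop atTop :=
    (tendsto_rpow_atTop (by linarith)).comp tendsto_natCast_atTop_atTop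
  obtain ⟨n, hn₁, hn₂⟩ := (hev.and (hlim.eventually_gt_atTop C)).exists
  exact absurd hn₁ (not_le.2 hn₂)

/-- The admissible exponents of `S` are nonempty (`15` is one). [cite: ChristandlVranaZuiddam2016, §1.2 (table)] -/
theorem sesquiAdmissibleExponents_nonempty : (sesquiAdmissibleExponents F).Nonempty :=
  ⟨15, fifteen_mem_sesquiAdmissibleExponents F⟩

/-- The admissible exponents of `S` are bounded below by `10`. [cite: ChristandlVranaZuiddam2016, §1.2 (flat)] -/
theorem sesquiAdmissibleExponents_bddBelow : BddBelow (sesquiAdmissibleExponents F) :=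
  ⟨10, fun _ hβ => ten_le_of_mem_sesquiAdmissibleExponents F hβ⟩

/-- Admissible exponents are upward closed. [folklore] -/
theorem mem_sesquiAdmissibleExponents_of_le {β γ : ℝ} (hβ : β ∈ sesquiAdmissibleExponents F)
    (h : β ≤ γ) : γ ∈ sesquiAdmissibleExponents F := by
  refine hβ.trans ?_
  refine IsBigO.of_bound 1 ?_
  filter_upwards [eventually_ge_atTop 1] with n hn
  have hn' : (1 : ℝ) ≤ n := by exact_mod_cast hn
  rw [one_mul, Real.norm_of_nonneg (Real.rpow_nonneg (by positivity) _),
    Real.norm_of_nonneg (Real.rpow_nonneg (by positivity) _)]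
  exact Real.rpow_le_rpow_of_exponent_le hn' h

/-- **`Ω ≥ 10`** (flattening). [cite: ChristandlVranaZuiddam2016, §1.2] -/
theorem ten_le_omegaSesqui : 10 ≤ omegaSesqui F :=
  le_csInf (sesquiAdmissibleExponents_nonempty F)
    fun _ hβ => ten_le_of_mem_sesquiAdmissibleExponents F hβ

/-- **`Ω ≤ 15`** (trivial cover). [cite: ChristandlVranaZuiddam2016, §1.2] -/
theorem omegaSesqui_le_fifteen : omegaSesqui F ≤ 15 :=
  csInf_le (sesquiAdmissibleExponents_bddBelow F) (fifteen_mem_sesquiAdmissibleExponents F)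

/-- Any exponent strictly above `Ω` is admissible. [folklore] -/
theorem mem_sesquiAdmissibleExponents_of_lt {β : ℝ} (h : omegaSesqui F < β) :
    β ∈ sesquiAdmissibleExponents F := by
  obtain ⟨γ, hγ, hγβ⟩ := (csInf_lt_iff (sesquiAdmissibleExponents_bddBelow F)
    (sesquiAdmissibleExponents_nonempty F)).1 h
  exact mem_sesquiAdmissibleExponents_of_le F hγ hγβ.le

/-! ## The Kronecker cover in exponents: `Ω ≤ ω(K₄) + ω(W) ≤ 5ω`, `ConeFlat ⟹ SesquiFlat`,
`SesquiNoSaving ⟹ ConeNoSaving` -/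

/-- If `β` is admissible for `T(K₄)` and `γ` for `W`, then `β + γ` is admissible for `S`
(`R₄(S_n) ≤ R₄(T(K₄)_n) · R₄(W_n)`). [cite: ChristandlVranaZuiddam2016, Prop. 1.1.16] -/
theorem add_mem_sesquiAdmissibleExponents {β γ : ℝ} (hβ : β ∈ tetraAdmissibleExponents F)
    (hγ : γ ∈ coneAdmissibleExponents F) : β + γ ∈ sesquiAdmissibleExponents F := by
  have h : (fun n : ℕ => (tensorRankD (tetra F n) : ℝ) * (tensorRankD (cone F n) : ℝ)) =O[atTop]
      fun n : ℕ => (n : ℝ) ^ β * (n : ℝ) ^ γ := hβ.mul hγ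
  refine (IsBigO.trans ?_ h).trans ?_
  · refine IsBigO.of_bound 1 (Eventually.of_forall fun n => ?_)
    rw [one_mul, Real.norm_of_nonneg (Nat.cast_nonneg _),
      Real.norm_of_nonneg (mul_nonneg (Nat.cast_nonneg _) (Nat.cast_nonneg _))]
    exact_mod_cast tensorRankD_sesqui_le (F := F) n
  · refine IsBigO.of_bound 1 ?_
    filter_upwards [eventually_gt_atTop 0] with n hn
    have hn' : (0 : ℝ) < n := by exact_mod_cast hn
    show ‖(n : ℝ) ^ β * (n : ℝ) ^ γ‖ ≤ 1 * ‖(n : ℝ) ^ (β + γ)‖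
    rw [one_mul, Real.rpow_add hn']

/-- **`Ω ≤ ω(K₄) + ω(W)`** (the Kronecker cover `S = T(K₄) ⊠ W`), for every field.
[cite: ChristandlVranaZuiddam2016, Prop. 1.1.16] -/
theorem omegaSesqui_le_omegaTetra_add_omegaCone :
    omegaSesqui F ≤ omegaTetra F + omegaCone F := by
  have h1 : ∀ γ ∈ coneAdmissibleExponents F, omegaSesqui F - γ ≤ omegaTetra F := fun γ hγ => by
    refine le_csInf (tetraAdmissibleExponents_nonempty F) fun β hβ => ?_
    have := csInf_le (sesquiAdmissibleExponents_bddBelow F)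
      (add_mem_sesquiAdmissibleExponents F hβ hγ)
    change omegaSesqui F ≤ β + γ at this
    linarith
  have h2 : omegaSesqui F - omegaTetra F ≤ omegaCone F :=
    le_csInf (coneAdmissibleExponents_nonempty F) fun γ hγ => by
      have := h1 γ hγ
      linarith
  linarith

/-- **The triangle cover `Ω ≤ 5ω`** (`Ω ≤ ω(K₄) + ω(W) ≤ 2ω + 3ω`: five triangles of sizes `n` resp.
`n²` cover the weighted tetrahedron), for every field. [cite: ChristandlVranaZuiddam2016, Prop. 1.1.26] -/
theorem omegaSesqui_le_five_mul_omega : omegaSesqui F ≤ 5 * omega F := by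
  have h₁ := omegaSesqui_le_omegaTetra_add_omegaCone F
  have h₂ := omegaTetra_le_two_mul_omega F
  have h₃ := omegaCone_le_three_mul_omega F
  linarith

/-- The kernel bracket `10 ≤ Ω ≤ 5ω`. [cite: ChristandlVranaZuiddam2016, §1.2] -/
theorem omegaSesqui_bracket : 10 ≤ omegaSesqui F ∧ omegaSesqui F ≤ 5 * omega F :=
  ⟨ten_le_omegaSesqui F, omegaSesqui_le_five_mul_omega F⟩

/-- **THE ATTACKED PIECE GOT STRONGER THAN THE CONE'S: `ConeFlat ⟹ SesquiFlat`**
(`ω(W) ≤ 6 → Ω ≤ 10`: `ConeFlat ⟹ TetraFlat`, `ω(K₄) ≤ 4`, and `Ω ≤ ω(K₄) + ω(W)`), every field. [folklore] -/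
theorem omegaSesqui_le_ten_of_omegaCone_le_six (h : omegaCone F ≤ 6) : omegaSesqui F ≤ 10 := by
  have h₁ := omegaSesqui_le_omegaTetra_add_omegaCone F
  have h₂ := omegaTetra_le_four_of_omegaCone_le_six F h
  linarith

/-- `TetraFlat` and `ConeFlat` together give `SesquiFlat` directly (`Ω ≤ 4 + 6`). [folklore] -/
theorem omegaSesqui_le_ten_of_flat (h₁ : omegaTetra F ≤ 4) (h₂ : omegaCone F ≤ 6) :
    omegaSesqui F ≤ 10 := by
  have := omegaSesqui_le_omegaTetra_add_omegaCone F
  linarith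

/-- **THE RESIDUAL IS AT LEAST AS WEAK AS BEFORE, PART 1: `SesquiNoSaving ⟹ ConeNoSaving`**
(`5ω ≤ Ω → 3ω ≤ ω(W)`, from `Ω ≤ ω(K₄) + ω(W) ≤ 2ω + ω(W)`), every field. [folklore] -/
theorem coneNoSaving_of_sesquiNoSaving (h : 5 * omega F ≤ omegaSesqui F) :
    3 * omega F ≤ omegaCone F := by
  have h₁ := omegaSesqui_le_omegaTetra_add_omegaCone F
  have h₂ := omegaTetra_le_two_mul_omega F
  linarith

/-- Quantitative form: `Ω - 2ω ≤ ω(W)` and `Ω - 3ω ≤ ω(K₄)`. [folklore] -/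
theorem omegaSesqui_sub_le :
    omegaSesqui F - 2 * omega F ≤ omegaCone F ∧ omegaSesqui F - 3 * omega F ≤ omegaTetra F := by
  have h₁ := omegaSesqui_le_omegaTetra_add_omegaCone F
  have h₂ := omegaTetra_le_two_mul_omega F
  have h₃ := omegaCone_le_three_mul_omega F
  constructor <;> linarith

/-! ## The rim cover in exponents: `3·ω(K₄) ≤ ω + Ω`, `TetraNoSaving ⟹ SesquiNoSaving` -/

/-- **`3·ω(K₄) ≤ ω + Ω`**, for every field: from `R₄(T(K₄)_{N·N²}) ≤ R(⟨N,N,N⟩)·R₄(S_N) ≤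
C N^β · D N^γ ≤ (N·N²)^{(β+γ+ε)/3}` at one large level `N` and the level certificate
`omegaTetra_le_of_level`. [cite: ChristandlVranaZuiddam2016, Prop. 1.1.16] -/
theorem three_mul_omegaTetra_le_omega_add_omegaSesqui :
    3 * omegaTetra F ≤ omega F + omegaSesqui F := by
  have key : ∀ β ∈ admissibleExponents F, ∀ γ ∈ sesquiAdmissibleExponents F, ∀ ε : ℝ, 0 < ε →
      omegaTetra F ≤ (β + γ + ε) / 3 := by
    intro β hβ γ hγ ε hε
    have hβ2 : 2 ≤ β := admissibleExponents_two_le F hβ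
    have hγ10 : 10 ≤ γ := ten_le_of_mem_sesquiAdmissibleExponents F hγ
    obtain ⟨C, hC0, hC⟩ := isBigO_iff'.1 hβ
    obtain ⟨D, hD0, hD⟩ := isBigO_iff'.1 hγ
    have hCDε : ∀ᶠ N : ℕ in atTop, C * D ≤ (N : ℝ) ^ ε :=
      ((tendsto_rpow_atTop hε).comp tendsto_natCast_atTop_atTop).eventually_ge_atTop (C * D)
    obtain ⟨N, ⟨⟨hN2, hCDN⟩, hRN⟩, hSN⟩ :=
      ((((eventually_ge_atTop 2).and hCDε).and hC).and hD).exists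
    rw [Real.norm_of_nonneg (Nat.cast_nonneg _),
      Real.norm_of_nonneg (Real.rpow_nonneg (Nat.cast_nonneg _) _)] at hRN hSN
    have hNpos : (0 : ℝ) < N := by exact_mod_cast (show 0 < N by omega)
    have hL2 : 2 ≤ N * (N * N) :=
      hN2.trans (Nat.le_mul_of_pos_right N (Nat.mul_pos (by omega) (by omega)))
    have hθ : 0 ≤ (β + γ + ε) / 3 := by linarith
    refine omegaTetra_le_of_level F hL2 hθ ?_
    have h1 : (tensorRankD (tetra F (N * (N * N))) : ℝ) ≤
        (tensorRank (matMulTensor F N N N) : ℝ) * (tensorRankD (sesqui F N) : ℝ) := by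
      exact_mod_cast tensorRankD_tetra_cube_le_mul_sesqui (F := F) N
    have h2 : (tensorRank (matMulTensor F N N N) : ℝ) * (tensorRankD (sesqui F N) : ℝ) ≤
        (C * (N : ℝ) ^ β) * (D * (N : ℝ) ^ γ) :=
      mul_le_mul hRN hSN (Nat.cast_nonneg _) (by positivity)
    have h3 : (C * (N : ℝ) ^ β) * (D * (N : ℝ) ^ γ) = (C * D) * (N : ℝ) ^ (β + γ) := by
      rw [Real.rpow_add hNpos]
      ring
    have h4 : (C * D) * (N : ℝ) ^ (β + γ) ≤ (N : ℝ) ^ ε * (N : ℝ) ^ (β + γ) :=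
      mul_le_mul_of_nonneg_right hCDN (Real.rpow_nonneg hNpos.le _)
    have h6 : (((N * (N * N) : ℕ)) : ℝ) = (N : ℝ) ^ (3 : ℝ) := by
      rw [show (3 : ℝ) = ((3 : ℕ) : ℝ) by norm_num, Real.rpow_natCast]
      push_cast
      ring
    have h5 : (N : ℝ) ^ ε * (N : ℝ) ^ (β + γ) = (((N * (N * N) : ℕ)) : ℝ) ^ ((β + γ + ε) / 3) := by
      rw [← Real.rpow_add hNpos, h6, ← Real.rpow_mul hNpos.le]
      congr 1
      ring
    calc (tensorRankD (tetra F (N * (N * N))) : ℝ)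
        ≤ (tensorRank (matMulTensor F N N N) : ℝ) * (tensorRankD (sesqui F N) : ℝ) := h1
      _ ≤ (C * (N : ℝ) ^ β) * (D * (N : ℝ) ^ γ) := h2
      _ = (C * D) * (N : ℝ) ^ (β + γ) := h3
      _ ≤ (N : ℝ) ^ ε * (N : ℝ) ^ (β + γ) := h4
      _ = (((N * (N * N) : ℕ)) : ℝ) ^ ((β + γ + ε) / 3) := h5
  by_contra hlt
  rw [not_le] at hlt
  set δ := 3 * omegaTetra F - (omega F + omegaSesqui F) with hδdef
  have hδ : 0 < δ := by linarith
  obtain ⟨β, hβ, hβlt⟩ := (csInf_lt_iff (admissibleExponents_bddBelow F)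
    (admissibleExponents_nonempty F)).1 (show omega F < omega F + δ / 4 by linarith)
  have hγ : omegaSesqui F + δ / 4 ∈ sesquiAdmissibleExponents F :=
    mem_sesquiAdmissibleExponents_of_lt F (by linarith)
  have hkey := key β hβ _ hγ (δ / 4) (by linarith)
  linarith

/-- **THE RESIDUAL IS AT LEAST AS WEAK AS BEFORE, PART 2: `TetraNoSaving ⟹ SesquiNoSaving`**
(`2ω ≤ ω(K₄) → 5ω ≤ Ω`, from `3·ω(K₄) ≤ ω + Ω`), for every field: nothing saved over two triangles ⟹
nothing saved over the five (three of size `n`, two more of size `n` inside `W`) covering `S`. [folklore] -/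
theorem sesquiNoSaving_of_tetraNoSaving (h : 2 * omega F ≤ omegaTetra F) :
    5 * omega F ≤ omegaSesqui F := by
  have := three_mul_omegaTetra_le_omega_add_omegaSesqui F
  linarith

/-- **THE RESIDUAL CHAIN OF THE SPOKE/RIM FAMILY** (`u = 1 → 3/2 → 2`):
`TetraNoSaving ⟹ SesquiNoSaving ⟹ ConeNoSaving`, every field. [folklore] -/
theorem noSaving_chain :
    (2 * omega F ≤ omegaTetra F → 5 * omega F ≤ omegaSesqui F) ∧
      (5 * omega F ≤ omegaSesqui F → 3 * omega F ≤ omegaCone F) :=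
  ⟨sesquiNoSaving_of_tetraNoSaving F, coneNoSaving_of_sesquiNoSaving F⟩

/-- Contrapositive bookkeeping: a saving for `S` is a saving for the tetrahedron,
`Ω < 5ω ⟹ ω(K₄) < 2ω` (quantitatively `ω(K₄) ≤ (ω + Ω)/3`). [folklore] -/
theorem omegaTetra_lt_two_mul_omega_of_omegaSesqui_lt (h : omegaSesqui F < 5 * omega F) :
    omegaTetra F < 2 * omega F := by
  have := three_mul_omegaTetra_le_omega_add_omegaSesqui F
  linarith

/-- **What `SesquiFlat` gives for the tetrahedron through the rim cover: `Ω ≤ 10 ⟹ ω(K₄) ≤ (ω + 10)/3`**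
(so `< 4.13` with `ω < 2.38`, beating the two-triangle cover `ω(K₄) ≤ 2ω` as soon as `ω > 2`; the full
`SesquiFlat ⟹ TetraFlat` is CVZ19 Prop. 2.1.7 with `f = (n³,n³,n³,n²,n²,n²)`). [cite: ChristandlVranaZuiddam2016, Prop. 2.1.7] -/
theorem omegaTetra_le_of_omegaSesqui_le_ten (h : omegaSesqui F ≤ 10) :
    omegaTetra F ≤ (omega F + 10) / 3 := by
  have := three_mul_omegaTetra_le_omega_add_omegaSesqui F
  linarith

/-- **A sesqui level bound is a tetrahedron instrument**: `3·ω(K₄) ≤ ω + Ω` turns any upper bound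
`Ω ≤ θ` into `ω(K₄) ≤ (ω + θ)/3`; with the cover `ω(K₄) ≤ 2ω` this reads
`ω(K₄) ≤ min(2ω, (ω + θ)/3)`. [folklore] -/
theorem omegaTetra_le_min_of_omegaSesqui_le {θ : ℝ} (h : omegaSesqui F ≤ θ) :
    omegaTetra F ≤ min (2 * omega F) ((omega F + θ) / 3) := by
  refine le_min (omegaTetra_le_two_mul_omega F) ?_
  have := three_mul_omegaTetra_le_omega_add_omegaSesqui F
  linarith

/-- **A single sesqui certificate is a tetrahedron instrument (finite form)**: `R₄(S_N) ≤ N^θ` at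
ONE level `N ≥ 2` gives `ω(K₄) ≤ 1 + θ/3` (rim cover with the standard algorithm `R(⟨N,N,N⟩) ≤ N³`:
`R₄(T(K₄)_{N·N²}) ≤ N³·N^θ = (N·N²)^{1+θ/3}`, then `omegaTetra_le_of_level`); a certificate at the
flattening value `θ = 10` would already give `ω(K₄) ≤ 13/3`. [cite: ChristandlVranaZuiddam2016, Prop. 1.1.16] -/
theorem omegaTetra_le_of_sesqui_level {N : ℕ} {θ : ℝ} (hN : 2 ≤ N) (hθ : 0 ≤ θ)
    (hcert : (tensorRankD (sesqui F N) : ℝ) ≤ (N : ℝ) ^ θ) :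
    omegaTetra F ≤ 1 + θ / 3 := by
  have hNpos : (0 : ℝ) < N := by exact_mod_cast (show 0 < N by omega)
  have hL2 : 2 ≤ N * (N * N) :=
    hN.trans (Nat.le_mul_of_pos_right N (Nat.mul_pos (by omega) (by omega)))
  have hθ' : 0 ≤ 1 + θ / 3 := by positivity
  refine omegaTetra_le_of_level F hL2 hθ' ?_
  have h1 : (tensorRankD (tetra F (N * (N * N))) : ℝ) ≤
      (tensorRank (matMulTensor F N N N) : ℝ) * (tensorRankD (sesqui F N) : ℝ) := by
    exact_mod_cast tensorRankD_tetra_cube_le_mul_sesqui (F := F) N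
  have h2 : (tensorRank (matMulTensor F N N N) : ℝ) ≤ (N : ℝ) ^ (3 : ℝ) := by
    rw [show (3 : ℝ) = ((3 : ℕ) : ℝ) by norm_num, Real.rpow_natCast]
    have h := tensorRank_matMulTensor_le F N N N
    calc (tensorRank (matMulTensor F N N N) : ℝ) ≤ ((N * N * N : ℕ) : ℝ) := by exact_mod_cast h
      _ = (N : ℝ) ^ 3 := by
        push_cast
        ring
  have h6 : (((N * (N * N) : ℕ)) : ℝ) = (N : ℝ) ^ (3 : ℝ) := by
    rw [show (3 : ℝ) = ((3 : ℕ) : ℝ) by norm_num, Real.rpow_natCast]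
    push_cast
    ring
  calc (tensorRankD (tetra F (N * (N * N))) : ℝ)
      ≤ (tensorRank (matMulTensor F N N N) : ℝ) * (tensorRankD (sesqui F N) : ℝ) := h1
    _ ≤ (N : ℝ) ^ (3 : ℝ) * (N : ℝ) ^ θ :=
        mul_le_mul h2 hcert (Nat.cast_nonneg _) (Real.rpow_nonneg hNpos.le _)
    _ = (((N * (N * N) : ℕ)) : ℝ) ^ (1 + θ / 3) := by
        rw [← Real.rpow_add hNpos, h6, ← Real.rpow_mul hNpos.le]
        congr 1
        ring

/-- The two-sided kernel sandwich of `Ω` inside the family: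
`max(10, 3ω(K₄) - ω) ≤ Ω ≤ min(5ω, ω(K₄) + ω(W))`. [folklore] -/
theorem omegaSesqui_sandwich :
    max 10 (3 * omegaTetra F - omega F) ≤ omegaSesqui F ∧
      omegaSesqui F ≤ min (5 * omega F) (omegaTetra F + omegaCone F) := by
  refine ⟨max_le (ten_le_omegaSesqui F) ?_,
    le_min (omegaSesqui_le_five_mul_omega F) (omegaSesqui_le_omegaTetra_add_omegaCone F)⟩
  have := three_mul_omegaTetra_le_omega_add_omegaSesqui F
  linarith

end Exponent

end Summit.MatrixMultiplication.MatrixMultiplication.Theorems.SesquiTensor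

end
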